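import HarnessLib
import Summits.Langlands.Langlands.Theses.QuarterDeficit1951
import Summits.Langlands.Langlands.Theorems.CensusDeficit1951.Negative.CensusDeficit1951FalseOfEvenIcosahedralMaassFormAt1951
import Summits.Langlands.Langlands.Theorems.CensusDeficit1951.Negative.CensusDeficit1951FalseOfOddWindowCertificate
import Summits.Langlands.Langlands.Theorems.CensusDeficit1951.Negative.CensusDeficit1951FalseOfTwoWindowMaassCuspFormsAt1951
import Summits.Langlands.Langlands.Theorems.QuarterFingerprintDeficit.Negative.FalseWithoutNonzero
import Summits.Langlands.Langlands.Theorems.QuarterDeficit1951CensusDeficit1951Calibration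
import Summits.Langlands.Langlands.Theorems.QuarterDeficit1951CensusDecoding
import Summits.Langlands.Langlands.Theorems.QuarterDeficit1951WindowFormDictionary

/-!
# Disproof of `CensusDeficit1951` — findings (disprover cycle 1, 2026-08-17)

Crux D = `Summit.Langlands.Langlands.Theses.QuarterDeficit1951.CensusDeficit1951` (item stmt-Langlands-17933,
route `route-Langlands-QuarterDeficit1951`, rank 2, verdict class computation): for EVERY Dirichlet character
`χ mod 1951` of order `5` there is a transcript `c : MaassHeckeTraceCensus` with `window ≥ 1/100`, `fpTol ≥ 1/100`,
`fpPrimes ⊆ {2,3,5,7,11,13}` which IS a certified census of the weight-0 cuspidal spectrum of `(Γ₀(1951), χ)`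
(`CertifiedMaassHeckeTraceCensus 1951 χ c`: well-formed boxes enclosing the `h`-weighted Hecke traces of COMPLETE joint
spectral data) and whose kernel-decidable verdict `c.certifiesDeficit` is `true` (`U = 0`, or `U = 1` with the
fingerprint certifiedly violated at some `p ∈ fpPrimes`).

## Verdict of this cycle: NOT KILLED IN-KERNEL — numerically FALSE — and exactly why it resists

* **D is numerically false for all four order-5 characters** (tree evidence, not mine:
  `Cruxes/QuarterFingerprintDeficit/SightingHejhalR0.md`, kit j020406/7, j020748/9 — Hejhal's linear system at `r = 0`
  sights an ODD weight-0 newform on `(Γ₀(1951), χ)` for every order-5 `χ`, `a_p ∈ ℤ[ζ₅]` exact to `2·10⁻¹²`,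
  `|a_p|² ∈ Φ` to `6·10⁻¹²` at `p ≤ 13`, 2359/2359 Frobenius matches with the Doud–Moore `A₅` quintic
  `x⁵ − x⁴ − 780x³ − 1795x² + 3106x + 344` (cycle types re-checked here by hand: `(3,1,1),(5),(2,2,1),(2,2,1),(5),(3,1,1)`
  at `p = 2,3,5,7,11,13`, so `|a_p|² = 1, (3±√5)/2, 0, 0, (3±√5)/2, 1`); and `Cruxes/CensusDeficit1951/SCAN-RESULTS-k1.md`,
  kit j025333–6 — Hejhal SCANS of both parities, `r ∈ [0, 0.13] ∪ i(0, 0.11]`: the window `|λ − 1/4| ≤ 1/100` of each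
  of the four spaces contains EXACTLY ONE line, the odd `r = 0` form; the nearest other line is an even form of
  `(Γ₀(1951), χ₁)` at `λ − 1/4 = 0.010866`, outside the window by `8.7·10⁻⁴`). Hence for every `χ` every certifiable
  transcript has `U ≥ 1` and `violates p = false` at every `p`, i.e. `certifiesDeficit = false`: D is false in every
  world consistent with these numerics — by `heckeViolation_of_censusDeficit1951` below, D PREDICTS that this unique
  window line is `T_p`-eigen at some `p ≤ 13` with `dist(μ_p² χ̄(p), Φ) > 1/100`, against a measured `≤ 6·10⁻¹²`.
* **In-kernel, D is independent of everything constructible today** (two-sided calibration, all kernel-checked):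
  `¬D ⊢` a non-zero weight-0 Maass cusp form on `(Γ₀(1951), χ)` for an order-5 `χ`
  (`exists_cuspForm_ne_zero_of_not_CensusDeficit1951`, lead c2, p164134 — the `J = ∅` model: with no cusp forms the toy
  transcript `h = sinc⁴(r/2)` IS a certified deficit census); conversely ONE window cusp form with fingerprint-compatible
  Hecke eigenvalues (if any) `⊢ ¬D` (`not_censusDeficit1951_of_compatibleWindowForm`, THIS seat, §3; sharper than the
  landed p158485 / p161038 which assume a joint eigenform resp. an odd certificate with boxes), and TWO window cusp forms
  `⊢ ¬D` (p161187). No weight-0 Maass cusp form of any level is constructible in Mathlib (no `K`-Bessel/Whittaker theory,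
  no spectral theorem for `L²(Γ\ℍ)`, no trace formula, no theta lift from real quadratic fields — and at the PRIME level
  `1951 ≡ 3 (mod 4)` the order-5 spaces contain no dihedral forms anyway: conductor-1951 dihedral representations are
  induced from `ℚ(√−1951)`, odd); the intended form's automorphy is the open EVEN icosahedral case of Artin's conjecture
  (Calegari ICM 2022 §12, `Literature.Barriers.Langlands.NonRegularWeightBarrier`, bites the disproof direction).
* **Therefore no `…CensusDeficit1951Refutation.lean` can be landed this cycle.** The decisive object for `¬D` on the
  ledger is the parent crux's Arb certificate (CERTIFICATE-B: odd cusp form within `ε` of `λ = 1/4` on `(Γ₀(1951), χ₁)`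
  by an odd-sector point-pair quasimode — the Eisenstein series of an even character are `R`-even, p157390, so `L²_odd`
  is cuspidal; Milestone C: six Hecke boxes by the BSV joint-quasimode pigeonhole, p128255) ⇒ `OddWindowCertificate`
  (def p158019) ⇒ `¬D` by p161038, verdict class computation. Lead c2 of this crux recommends parking D
  `blocked-on OddWindowCertificate`; I concur (§4).

## What was attacked (cheap attacks, all logged in the disprover's NOTES.md)

1. Elaboration/typing: `rc 0` (W.lean); D read back symbol by symbol; `Iff.rfl` restatement `censusDeficit_iff` (§0).
2. Junk-model hunt on the format (the only route to a CHEAP kernel kill): NONE. `IsMaassCuspFormOn` is honest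
   (`IsC2` = `ContDiffOn ℝ 2` on the open half-plane so Mathlib's `Δ` is the true Laplacian; `ofComplex` only at
   points of positive imaginary part; `−I ∈ Γ₀(1951)` harmless since order-5 characters are even; the period-`N`
   cuspidality integrals are integrals of continuous bounded functions, no interval-integral junk; bounded + cuspidal +
   eigen ⇒ genuine cusp form); `maassHeckeOp_prime` is BLS20 §1.1's `T_p` with `χ(p)` on the `u(pz)` term, matching the
   automorphy convention `u(γz) = χ(d)u(z)`, so `μ_p² χ̄(p) = tr²/det` on the Galois side (and C2a is PROVED in-kernel
   with this convention); `IsJointSpectralData` (completeness + linear independence + `λ_j > 0` + trivial Hecke bound)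
   and `EnclosesSpectralData` pin a certified transcript to the TRUE spectrum; the decidable shell alone is trivially
   inhabited (toy transcripts, `decide +kernel`) but the semantic `Prop` is inhabited in-kernel exactly when the
   spectrum is provably empty (§1, and c2's calibration).
3. Vacuity / degenerate regimes: the `∀ χ` is non-vacuous (`exists_dirichletCharacter_orderOf_eq_five`, in tree); for
   ODD characters D's clause is TRUE in-kernel (§1 `clause_of_apply_neg_one`: `−I` kills every form, `J = ∅` census),
   and odd characters exist (`exists_apply_neg_one`, Legendre symbol, `1951 ≡ 3 mod 4`), so the variant of D over ALL
   characters reduces to the even ones (`allCharacters_iff_even`) — the order-5 hypothesis is load-bearing only as a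
   parity/sector restriction; no variant obtained by dropping or weakening it is refutable in-kernel either.
4. Strengthenings / weakenings of the constants: forcing a larger window or a smaller prime set only makes D harder
   (`censusDeficitWith_mono`, §2); the `U = 0` strengthening (`VacancyCensus1951`, strategist s3) dies on ONE
   Laplace-only window form; nothing is decidable in-kernel.
5. Small-model computation: the deciding numerics exist already (sighting + scans above); re-derived here only the
   Frobenius cycle types of the quintic at `p ≤ 31` (pure integer arithmetic) — consistent. No new kit job: nothing a
   job can return changes the kernel status, and the certificate computation is owned by the parent lead (no duplicate).
6. Literature / barriers / negatives: `ledger negatives --problem Langlands` has one unrelated entry (K3 SerreTypeAnchor);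
   no `Theorems/*Refutation.lean` on Maass forms; BLS20 (arXiv:1803.06016) Thm 2/§5 is an UPPER-bound device conditional
   on Artin, the unconditional sighting "has not yet been carried out" (their §1); Booker 2006 (math/0507502) p. 3:
   BSV-type computation gives Maass forms "to within a prescribed precision, never exactly" — i.e. exactly the
   verdict-class-computation situation of this crux. `NonRegularWeightBarrier` bites `¬D` (no modularity engine for
   weight `(0,0)` even `A₅`); `SolvableImageBarrier` (Langlands–Tunnell) does not reach `A₅`.

## Contents
* §0 `censusDeficit_iff`, `not_censusDeficit_iff` — D and `¬D` over a named clause (what a refutation must instantiate: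
  ONE character, ALL transcripts).
* §1 parity regime: `clause_of_apply_neg_one`, `exists_apply_neg_one`, `allCharacters_iff_even`.
* §2 load-bearing table + `censusDeficitWith_mono` (monotonicity in the forced window / prime set).
* §3 the kill interval: `windowForm_pins_deficitTranscript`, `heckeViolation_of_censusDeficit1951`,
  `not_censusDeficit1951_of_compatibleWindowForm` (NEW, being landed as
  `Theorems/CensusDeficit1951/Negative/HeckeViolationOfCensusDeficit1951.lean`), `not_censusDeficit1951_of_not_quarterFingerprintDeficit`
  (any refutation of the parent target refutes D, via the PROVED CensusDecoding + WindowFormDictionary), and `example`s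
  composing the landed kills p158485 / p161038 / p161187 / p164134.
* §4 Targets — line `Sketch` (leads c1/c2): stub status and joint (in)consistency of the registered stub set.
* §5 Near-miss (one `sorry`, documented): `near_miss_certificateB`.
-/

set_option linter.dupNamespace false

noncomputable section

namespace Summit.Langlands.Langlands.Cruxes.CensusDeficit1951.Disproof

open scoped ComplexConjugate
open Literature.NumberTheory.Automorphic
open Summit.Langlands.Langlands.Theses.QuarterDeficit1951
open Summit.Langlands.Langlands.Theorems.QuarterFingerprintDeficit.Negative
  (exists_dirichletCharacter_orderOf_eq_five apply_neg_one_eq_one_of_orderOf_eq_five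
    eq_zero_of_automorphic_of_apply_neg_one OddWindowCertificate EvenIcosahedralMaassFormAt1951)
open Summit.Langlands.Langlands.Theorems.CensusDeficit1951
  (exists_certifiedDeficitCensus_of_forall_cuspForm_eq_zero exists_cuspForm_ne_zero_of_not_CensusDeficit1951)
open Summit.Langlands.Langlands.Theorems.CensusDeficit1951.Negative
open Summit.Langlands.Langlands.Theorems.QuarterDeficit1951 (CensusDecoding_proof WindowFormDictionary_proof)

/-! ## §0 The crux over a named clause -/

/-- D's per-character clause with the forced window `w`, tolerance `t` and prime set `P` as parameters
(the crux is `w = t = 1/100`, `P = {2,3,5,7,11,13}`). [folklore] -/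
def Clause (w t : ℚ) (P : Finset ℕ) (χ : DirichletCharacter ℂ 1951) : Prop :=
  ∃ c : MaassHeckeTraceCensus, w ≤ c.window ∧ t ≤ c.fpTol ∧ (∀ p ∈ c.fpPrimes, p ∈ P) ∧
    CertifiedMaassHeckeTraceCensus 1951 χ c ∧ c.certifiesDeficit = true

/-- D with the three constants as parameters. [folklore] -/
def CensusDeficitWith (w t : ℚ) (P : Finset ℕ) : Prop :=
  ∀ χ : DirichletCharacter ℂ 1951, orderOf χ = 5 → Clause w t P χ

/-- The crux IS `CensusDeficitWith (1/100) (1/100) {2,3,5,7,11,13}` (definitional). [folklore] -/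
theorem censusDeficit_iff : CensusDeficit1951 ↔ CensusDeficitWith (1 / 100) (1 / 100) {2, 3, 5, 7, 11, 13} :=
  Iff.rfl

/-- **The shape of `¬D`**: ONE order-5 character all of whose admissible certified transcripts fail the deficit
verdict. Every negation line must instantiate exactly this (cf. strategist s3 `not_censusDeficit1951_iff_forall`).
[folklore] -/
theorem not_censusDeficit_iff : ¬ CensusDeficit1951 ↔
    ∃ χ : DirichletCharacter ℂ 1951, orderOf χ = 5 ∧ ∀ c : MaassHeckeTraceCensus,
      (1 / 100 : ℚ) ≤ c.window → (1 / 100 : ℚ) ≤ c.fpTol →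
      (∀ p ∈ c.fpPrimes, p ∈ ({2, 3, 5, 7, 11, 13} : Finset ℕ)) →
      CertifiedMaassHeckeTraceCensus 1951 χ c → c.certifiesDeficit = false := by
  unfold CensusDeficit1951
  push Not
  simp only [Bool.not_eq_true]

/-! ## §1 Non-vacuity and the parity regime

The `∀ χ` ranges over a non-empty set (`exists_dirichletCharacter_orderOf_eq_five`, tree) of EVEN characters
(`apply_neg_one_eq_one_of_orderOf_eq_five`, tree). Replacing `orderOf χ = 5` by "odd" makes the clause TRUE in-kernel. -/

/-- **D's clause holds for every ODD character mod 1951** (any constants `w, t ≤ 1/100`, any `P`): `−I ∈ Γ₀(1951)`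
forces every `IsMaassCuspFormOn 1951 χ v λ` to vanish, and then the `J = ∅` toy transcript of the calibration file is an
admissible certified census with the deficit verdict. [folklore] -/
theorem clause_of_apply_neg_one (χ : DirichletCharacter ℂ 1951) (hodd : χ (-1) = -1) :
    Clause (1 / 100) (1 / 100) {2, 3, 5, 7, 11, 13} χ :=
  exists_certifiedDeficitCensus_of_forall_cuspForm_eq_zero χ fun v _ hv =>
    funext fun z => eq_zero_of_automorphic_of_apply_neg_one χ hodd v hv.slash z

/-- **Odd characters mod 1951 exist**: the Legendre symbol (`quadraticChar (ZMod 1951)` pushed to `ℂ`) has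
`χ(−1) = χ₄(1951) = −1` as `1951 ≡ 3 (mod 4)`. [folklore] -/
theorem exists_apply_neg_one : ∃ χ : DirichletCharacter ℂ 1951, χ (-1) = -1 := by
  haveI : Fact (Nat.Prime 1951) := ⟨by norm_num⟩
  refine ⟨(quadraticChar (ZMod 1951)).ringHomComp (Int.castRingHom ℂ), ?_⟩
  have h2 : ringChar (ZMod 1951) ≠ 2 := by rw [ZMod.ringChar_zmod_n]; norm_num
  have hq : quadraticChar (ZMod 1951) (-1) = -1 := by
    rw [quadraticChar_neg_one h2, ZMod.card 1951]
    exact ZMod.χ₄_nat_three_mod_four (by norm_num)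
  simp [MulChar.ringHomComp_apply, hq]

/-- **`orderOf χ = 5` is load-bearing only as a parity restriction**: D over ALL characters is equivalent to D over the
EVEN ones (the odd half is `clause_of_apply_neg_one`), and it implies D (order-5 characters are even). Neither side has a
kernel witness today. [folklore] -/
theorem allCharacters_iff_even :
    (∀ χ : DirichletCharacter ℂ 1951, Clause (1 / 100) (1 / 100) {2, 3, 5, 7, 11, 13} χ) ↔
    (∀ χ : DirichletCharacter ℂ 1951, χ (-1) = 1 → Clause (1 / 100) (1 / 100) {2, 3, 5, 7, 11, 13} χ) := by
  refine ⟨fun h χ _ => h χ, fun h χ => ?_⟩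
  have hsq : χ (-1) * χ (-1) = 1 := by rw [← map_mul, neg_one_mul, neg_neg, map_one]
  rcases mul_self_eq_one_iff.mp hsq with h1 | h1
  · exact h χ h1
  · exact clause_of_apply_neg_one χ h1

/-- … and the all-(even-)characters variant implies the crux. [folklore] -/
theorem censusDeficit_of_allEven
    (h : ∀ χ : DirichletCharacter ℂ 1951, χ (-1) = 1 → Clause (1 / 100) (1 / 100) {2, 3, 5, 7, 11, 13} χ) :
    CensusDeficit1951 := fun χ hχ => h χ (apply_neg_one_eq_one_of_orderOf_eq_five χ hχ)

/-! ## §2 Load-bearing hypotheses and constants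

| ingredient of D | dropped / changed | kernel status | numerics |
|---|---|---|---|
| `orderOf χ = 5` | any χ | not refutable; `↔` even characters (§1) | false (same sighting; trivial character: Weyl ≈ 1.6 lines in the window) |
| `orderOf χ = 5` | odd χ | TRUE (`clause_of_apply_neg_one`) | — |
| `window ≥ 1/100` | `≥ w`, `w` larger | harder (`censusDeficitWith_mono`) | false |
| `window ≥ 1/100` | `≥ w`, `w < 1/100` | easier, still needs the spectrum | false for every `w > 0` (the `r = 0` line sits AT `λ = 1/4`) |
| `fpTol ≥ 1/100` | any `t > 0` | idem | false for every `t > 6·10⁻¹²`-ish (fingerprint exact) |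
| `fpPrimes ⊆ {2,…,13}` | larger prime set | easier | false while only primes are allowed (`|a_p|² ∈ Φ` for ALL `p ∤ 1951`, newform of an `A₅` rep); composite indices COULD leave `Φ` (`λ(4)²χ̄(4) = (φ₂ − 1)²`; `= 9 ∉ Φ` only if `Frob₂` were trivial — it has order 3) |
| `certifiesDeficit` | `upperCount = 0` (vacancy, s3) | dies on ONE Laplace-only window form | false |
| completeness in `IsJointSpectralData` | dropped | D becomes TRIVIALLY TRUE (`J = ∅` encloses nothing) — the format is sound only with it | — |
-/

/-- Monotonicity: forcing a larger window, a larger tolerance floor or a smaller prime set makes D harder. [folklore] -/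
theorem censusDeficitWith_mono {w w' t t' : ℚ} {P P' : Finset ℕ} (hw : w ≤ w') (ht : t ≤ t') (hP : P' ⊆ P) :
    CensusDeficitWith w' t' P' → CensusDeficitWith w t P := by
  rintro h χ hχ
  obtain ⟨c, h1, h2, h3, h4, h5⟩ := h χ hχ
  exact ⟨c, hw.trans h1, ht.trans h2, fun p hp => hP (h3 p hp), h4, h5⟩

/-- **Without completeness the format would be junk**: if `IsJointSpectralData` did not require every cusp form to lie
in the span of the listed lines, the EMPTY family would be joint spectral data of every `(Γ₀(N), χ)` and the toy
transcript would certify a deficit everywhere. Recorded as the statement that the empty family satisfies every OTHER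
field (the three pointwise ones vacuously; independence; the basis clause except completeness). [folklore] -/
theorem emptyFamily_all_but_completeness (N : ℕ) (χ : DirichletCharacter ℂ N) (P : Finset ℕ) :
    let d : PEmpty → MaassHeckeTraceCensus.SpectralLine := PEmpty.elim
    (∀ j, 0 < (d j).lam) ∧ (∀ j, (d j).hecke 1 = 1) ∧
    (∀ j, ∀ n ∈ P, ‖(d j).hecke n‖ * Real.sqrt n ≤ ArithmeticFunction.sigma 1 n) ∧
    ∃ u : PEmpty → (UpperHalfPlane → ℂ), (∀ j, IsMaassCuspFormOn N χ (u j) (d j).lam) ∧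
      (∀ j, ∀ n ∈ P, maassHeckeOp N χ n (u j) = (d j).hecke n • u j) ∧ LinearIndependent ℂ u :=
  ⟨fun j => j.elim, fun j => j.elim, fun j => j.elim, PEmpty.elim, fun j => j.elim, fun j => j.elim,
    linearIndependent_empty_type⟩

/-! ## §3 The kill interval: what D predicts of a window form, and what kills D -/

/-- **One window cusp form pins a deficit transcript** (this seat; being landed under `Negative/`). For a certified
transcript `c` of `(Γ₀(1951), χ)` with the deficit verdict and window `≥ 1/100`, a non-zero cusp form `v` with
`|λ − 1/4| ≤ 1/100` forces `U = 1`, `fpPrimes ≠ []`, makes `v` a `T_n`-eigenfunction at every recorded index (it is a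
multiple of the unique window line), and at some fingerprint prime the eigenvalue is more than `fpTol` off `Φ`.
[folklore] -/
theorem windowForm_pins_deficitTranscript {χ : DirichletCharacter ℂ 1951} {c : MaassHeckeTraceCensus}
    (hw : (1 / 100 : ℚ) ≤ c.window) (hc : CertifiedMaassHeckeTraceCensus 1951 χ c)
    (hv : c.certifiesDeficit = true) {v : UpperHalfPlane → ℂ} {lam : ℝ} (hform : IsMaassCuspFormOn 1951 χ v lam)
    (hv0 : v ≠ 0) (hwin : |lam - 1 / 4| ≤ 1 / 100) :
    c.upperCount = 1 ∧ c.fpPrimes ≠ [] ∧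
      ∃ μ : ℕ → ℂ, (∀ n ∈ c.indices, maassHeckeOp 1951 χ n v = μ n • v) ∧
        ∃ p ∈ c.fpPrimes, ∀ φ ∈ icosahedralFingerprint,
          (c.fpTol : ℝ) < ‖μ p ^ 2 * conj (χ (p : ZMod 1951)) - φ‖ := by
  have hc' := hc
  unfold CertifiedMaassHeckeTraceCensus at hc
  obtain ⟨-, hwf, J, d, hJ, hE⟩ := hc
  have hw' := window_cast hw
  obtain ⟨j₀, hj₀⟩ := exists_line_of_cuspForm hJ hform hv0
  have hwin₀ : c.inWindow (d j₀).lam := by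
    rw [MaassHeckeTraceCensus.inWindow, hj₀]; exact hwin.trans hw'
  obtain ⟨ub, -, hHecke, -, hspan⟩ := hJ.exists_eigenbasis
  have hv' := hv
  unfold MaassHeckeTraceCensus.certifiesDeficit at hv
  simp only [Bool.and_eq_true, Bool.or_eq_true, beq_iff_eq, List.any_eq_true] at hv
  obtain ⟨-, hU | ⟨hU, p₀, hp₀, -⟩⟩ := hv
  · exact absurd hwin₀ (MaassHeckeTraceCensus.not_inWindow_of_upperCount_eq_zero hJ hE hwf hU j₀)
  · have huniq : ∀ j, c.inWindow (d j).lam → j = j₀ := fun j hj =>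
      MaassHeckeTraceCensus.window_subsingleton_of_upperCount_eq_one hJ hE hwf hU hj hwin₀
    have hS : {j | (d j).lam = lam} ⊆ ({j₀} : Set J) := by
      intro j hj
      simp only [Set.mem_setOf_eq] at hj
      have : c.inWindow (d j).lam := by
        rw [MaassHeckeTraceCensus.inWindow, hj]; exact hwin.trans hw'
      exact Set.mem_singleton_iff.mpr (huniq j this)
    have h2 : Submodule.span ℂ (ub '' {j | (d j).lam = lam}) ≤ Submodule.span ℂ {ub j₀} := by
      refine Submodule.span_mono ?_
      rintro x ⟨j, hj, rfl⟩
      have := hS hj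
      rw [Set.mem_singleton_iff] at this
      simp [this]
    obtain ⟨a, ha⟩ := Submodule.mem_span_singleton.mp (h2 (hspan v lam hform))
    have heig : ∀ n ∈ c.indices, maassHeckeOp 1951 χ n v = (d j₀).hecke n • v := by
      intro n hn
      rw [← ha, ← maassHeckeLM_apply, LinearMap.map_smul, maassHeckeLM_apply, hHecke j₀ n hn, smul_comm]
    have hsub : ∀ p ∈ c.fpPrimes, p ∈ c.indices := fun p hp =>
      Finset.mem_insert_of_mem (List.mem_toFinset.mpr hp)
    have hne : ∃ z, v z ≠ 0 := by
      by_contra h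
      push Not at h
      exact hv0 (funext h)
    obtain ⟨p₁, hp₁, hviol⟩ := MaassHeckeTraceCensus.not_fingerprinted hc' hv' hform hne (hwin.trans hw')
      (μ := fun n => (d j₀).hecke n) (fun p hp => heig p (hsub p hp))
    exact ⟨hU, List.ne_nil_of_mem hp₀, fun n => (d j₀).hecke n, heig, p₁, hp₁, hviol⟩

/-- **What D predicts of every window cusp form** (this seat): if D holds then for every order-5 `χ` every non-zero
weight-0 Maass cusp form on `(Γ₀(1951), χ)` with `|λ − 1/4| ≤ 1/100` is a `T_p`-eigenfunction at some prime `p ≤ 13`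
whose eigenvalue `μ` has `‖μ² χ̄(p) − φ‖ > 1/100` for EVERY `φ ∈ Φ`. Numerically false: the unique window line of each
space is the `r = 0` form with `|a_p|² ∈ Φ` to `6·10⁻¹²` at all six primes. [folklore] -/
theorem heckeViolation_of_censusDeficit1951 (hD : CensusDeficit1951) (χ : DirichletCharacter ℂ 1951)
    (hχ : orderOf χ = 5) {v : UpperHalfPlane → ℂ} {lam : ℝ} (hform : IsMaassCuspFormOn 1951 χ v lam)
    (hv0 : v ≠ 0) (hwin : |lam - 1 / 4| ≤ 1 / 100) :
    ∃ p ∈ ({2, 3, 5, 7, 11, 13} : Finset ℕ), ∃ μ : ℂ, maassHeckeOp 1951 χ p v = μ • v ∧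
      ∀ φ ∈ icosahedralFingerprint, (1 / 100 : ℝ) < ‖μ ^ 2 * conj (χ (p : ZMod 1951)) - φ‖ := by
  obtain ⟨c, hw, ht, hP, hc, hv⟩ := hD χ hχ
  obtain ⟨-, -, μ, heig, p, hp, hviol⟩ := windowForm_pins_deficitTranscript hw hc hv hform hv0 hwin
  have hsub : p ∈ c.indices := Finset.mem_insert_of_mem (List.mem_toFinset.mpr hp)
  have ht' : (1 / 100 : ℝ) ≤ (c.fpTol : ℝ) := by
    have h : ((1 / 100 : ℚ) : ℝ) ≤ (c.fpTol : ℝ) := by exact_mod_cast ht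
    push_cast at h
    exact h
  exact ⟨p, hP p hp, μ p, heig p hsub, fun φ hφ => ht'.trans_lt (hviol φ hφ)⟩

/-- **The weakest single-form kill of D** (this seat): one order-5 `χ` and one non-zero window cusp form whose
`T_p`-eigenvalue at each `p ≤ 13` — IF it has one; no eigen-property assumed — is within `1/100` of `Φ`.
A construction hypothesis of verdict class computation; it is implied by `OddWindowCertificate` and by the exact
`EvenIcosahedralMaassFormAt1951`. [folklore] -/
theorem not_censusDeficit1951_of_compatibleWindowForm
    (H : ∃ χ : DirichletCharacter ℂ 1951, orderOf χ = 5 ∧ ∃ (v : UpperHalfPlane → ℂ) (lam : ℝ),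
      IsMaassCuspFormOn 1951 χ v lam ∧ v ≠ 0 ∧ |lam - 1 / 4| ≤ 1 / 100 ∧
      ∀ p ∈ ({2, 3, 5, 7, 11, 13} : Finset ℕ), ∀ μ : ℂ, maassHeckeOp 1951 χ p v = μ • v →
        ∃ φ ∈ icosahedralFingerprint, ‖μ ^ 2 * conj (χ (p : ZMod 1951)) - φ‖ ≤ 1 / 100) :
    ¬ CensusDeficit1951 := by
  intro hD
  obtain ⟨χ, hχ, v, lam, hform, hv0, hwin, hcompat⟩ := H
  obtain ⟨p, hp, μ, heig, hviol⟩ := heckeViolation_of_censusDeficit1951 hD χ hχ hform hv0 hwin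
  obtain ⟨φ, hφ, hle⟩ := hcompat p hp μ heig
  exact absurd hle (not_le.mpr (hviol φ hφ))

/-- **Any refutation of the parent target refutes D**: `CensusDecoding` and `WindowFormDictionary` are PROVED
(p-landed `CensusDecoding_proof`, `WindowFormDictionary_proof`), so `¬ QuarterFingerprintDeficit → ¬ D`. In
particular the parent crux's landed kills (`QuarterFingerprintDeficit_false_of_OddWindowCertificate`,
`…_false_of_EvenIcosahedralMaassFormAt1951`) transfer to D verbatim. [folklore] -/
theorem not_censusDeficit1951_of_not_quarterFingerprintDeficit (h : ¬ QuarterFingerprintDeficit) :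
    ¬ CensusDeficit1951 := fun hD => h (CensusDecoding_proof hD WindowFormDictionary_proof)

/-- The landed kills, by name (p158485, p161038, p161187) and the landed calibration (p164134). [folklore] -/
example : EvenIcosahedralMaassFormAt1951 → ¬ CensusDeficit1951 :=
  CensusDeficit1951_false_of_EvenIcosahedralMaassFormAt1951
example : OddWindowCertificate → ¬ CensusDeficit1951 := CensusDeficit1951_false_of_OddWindowCertificate
example : TwoWindowMaassCuspFormsAt1951 → ¬ CensusDeficit1951 :=
  CensusDeficit1951_false_of_TwoWindowMaassCuspFormsAt1951
example (h : ¬ CensusDeficit1951) : ∃ χ : DirichletCharacter ℂ 1951, orderOf χ = 5 ∧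
    ∃ (u : UpperHalfPlane → ℂ) (lam : ℝ), IsMaassCuspFormOn 1951 χ u lam ∧ u ≠ 0 :=
  exists_cuspForm_ne_zero_of_not_CensusDeficit1951 h

/-! ## §4 Targets — line `Sketch` (lead c1 → c2), payload `targets = []`, `stuck_stubs = []`

Registered skeleton `Cruxes/CensusDeficit1951/Lines/Sketch.lean` (c2 reshape 2026-08-17T13:55Z):
* `stub_oddWindowCertificate : OddWindowCertificate` — DECISIVE, computation class, shared with the parent crux's P4.
  Attack: none possible in-kernel (its negation asserts non-existence of an odd window form with fingerprinted boxes,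
  i.e. contradicts the sighting); as TYPED it is an existence statement about a TRUE eigenfunction, so the Arb run
  delivers it only through the (unformalised) spectral theorem on `L²_odd(Γ₀(1951)\ℍ, χ)` + BSV pigeonhole — consistent
  with verdict class computation; no typing defect found (the `let`s are verbatim the route's; `J • z = −z̄`; boxes
  `r(2‖a‖ + r) ≤ 1/100` give the windowed fingerprint by `norm_sq_mul_sub_sq_mul_le`). NOT BROKEN; numerically TRUE.
* `stub_pairDeficit` — D on a pair `{χ₀, χ₀²}`; EXPECTED FALSE by its own author; numerically false (above); in-kernel
  unbreakable for the same reason as D (`exists_cuspForm_ne_zero_of_not_CensusDeficit1951` applies verbatim to it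
  composed with `CensusDeficit1951_of`). Nothing to add.
* `stub_calibration` (CLOSED p164134), `stub_conjTransport` (CLOSED p158923): proved; nothing to break.
* JOINT SUFFICIENCY: `not_CensusDeficit1951_of` is modus ponens on p161038 — no gap. NOTE the registered stub SET is
  jointly INCONSISTENT by design (`stub_oddWindowCertificate ⊢ ¬D`, `stub_pairDeficit ⊢ D`): recorded below so no
  worker is ever seated on both. -/

/-- The two open stubs of `Sketch` cannot both hold: the odd window certificate refutes D, while the pair-deficit
stub (here in its weakest consequence, D itself) asserts it. [folklore] -/
example (h₁ : OddWindowCertificate) (h₂ : CensusDeficit1951) : False :=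
  CensusDeficit1951_false_of_OddWindowCertificate h₁ h₂

/-! ## §5 Near-miss (the only `sorry` of this file, on purpose)

What CERTIFICATE-B alone delivers (an ODD cusp form on `(Γ₀(1951), χ₁)` with `|λ − 1/4| ≤ ε`, NO Hecke data; read
through the landed `stub_oddConstantTerms` + `isMaassCuspFormOn_of_two_cusps` it is a `WindowMaassCuspFormAt1951` in
strategist s3's sense) does NOT yet refute D: by `windowForm_pins_deficitTranscript` it pins every deficit transcript of
`χ₁` to `U = 1 ∧ fpPrimes ≠ []` and makes the certified form `T_p`-eigen at the recorded primes, but the kernel cannot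
exclude that its fingerprint is off `Φ` (that is Milestone C's content) nor produce a second window form (none exists
numerically for r ≤ 0.13). MISSING OBJECT: six Hecke boxes (Milestone C) — or, for `χ₁` only, a certificate of the
even neighbour at `λ − 1/4 = 0.010866` TOGETHER with a window `≥ 0.0109`, which D does not force (window may be exactly
`1/100`): so the neighbour route is closed for D as typed (it would kill only `CensusDeficitWith w` for `w ≥ 0.010866`,
by p161187's argument). -/

/-- NEAR-MISS (sorried on purpose; do not cite): a Laplace-only odd window form would refute D only together with
Hecke boxes or a second window form — see the section docstring for the obstruction. [folklore] -/
theorem near_miss_certificateB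
    (H : ∃ χ : DirichletCharacter ℂ 1951, orderOf χ = 5 ∧ ∃ (u : UpperHalfPlane → ℂ) (lam : ℝ),
      IsMaassCuspFormOn 1951 χ u lam ∧ u ≠ 0 ∧ |lam - 1 / 4| ≤ 1 / 100 ∧
      ∀ z : UpperHalfPlane, u (UpperHalfPlane.J • z) = - u z) :
    ¬ CensusDeficit1951 := by
  sorry

/-- What IS provable from a Laplace-only window form: D then commits, for that `χ`, to a `U = 1` FINGERPRINT transcript
(non-empty `fpPrimes`) — unreachable at any feasible bandlimit (`FormatResolutionBarrier.md`: `X ≳ 140–450` needed vs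
`X ≤ 40–50` feasible) — and to a violated fingerprint of the certified form at some `p ≤ 13`. [folklore] -/
theorem deficitTranscript_shape_of_windowForm (hD : CensusDeficit1951) {χ : DirichletCharacter ℂ 1951}
    (hχ : orderOf χ = 5) {u : UpperHalfPlane → ℂ} {lam : ℝ} (hu : IsMaassCuspFormOn 1951 χ u lam) (hu0 : u ≠ 0)
    (hwin : |lam - 1 / 4| ≤ 1 / 100) :
    ∀ c : MaassHeckeTraceCensus, (1 / 100 : ℚ) ≤ c.window → CertifiedMaassHeckeTraceCensus 1951 χ c →
      c.certifiesDeficit = true → c.upperCount = 1 ∧ c.fpPrimes ≠ [] := by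
  intro c hw hc hv
  have _ := hD χ hχ
  obtain ⟨h1, h2, -⟩ := windowForm_pins_deficitTranscript hw hc hv hu hu0 hwin
  exact ⟨h1, h2⟩

end Summit.Langlands.Langlands.Cruxes.CensusDeficit1951.Disproof

end
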